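import Literature.NumberTheory.EllipticCurves.TwoDescentOneRootKummerBridgeLocal
import Literature.NumberTheory.EllipticCurves.SelmerTorsionRestrictionTower
import Literature.NumberTheory.EllipticCurves.SelmerTorsionRestrictionKummer
import HarnessLib

/-!
# Local Cassels UNIFORMITY: one `M`-rational point serves every field over `M`

Sequel of `TwoDescentOneRootKummerBridgeLocal.lean`. There, for a `2`-Selmer class `c` of `E/k` read through
ONE root `θ ∈ K` of the `2`-division cubic (`K/k` a number field, `Φ(c) = [a] ∈ Kˣ/Kˣ²`), the class of `a` at a
place `w` of `K` was identified with the Cassels value `x(P_w) − θ` of SOME point `P_w ∈ E(K_w)` depending on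
`w`. For the `2`-descent KILL certificates (local insolubility of the `2`-covering at a prime `p` of `k`) one
needs the point to be `k_p`-RATIONAL and the SAME for every place `w ∣ p`: this is what this file proves.

* `exists_resTorsion_eq_kummerMapTorsion_of_mem_selmerGroup` — at a place `v` of `k`, a Selmer class restricts
  to the Kummer class of a point `P ∈ E(k_v)`: `res_{k_v} c = κ(P)` in `H¹(k_v, E_{k_v}[2])`;
* `oneRootCharH1_h1Equiv_torsionCongr` — the `θ`-character commutes with the transport along an equality of
  Weierstrass equations;
* `kummerEquiv_resMu_oneRootCharH1_eq_of_resTorsion_eq` — **uniformity**: for any field `L` over BOTH `K` and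
  `M` (compatibly over `k`; e.g. `M = k_p`, `L = K_w`, `w ∣ p`) and `P ∈ E(M)` with `res_M c = κ(P)`, the class
  of `Φ(c)` in `Lˣ/Lˣ²` is the Cassels value `oneRootComponent θ P_L` of the base change of `P` — proved by
  reading `res_L c` through the two towers `k ⊂ K ⊂ L`, `k ⊂ M ⊂ L` (`resTorsion_resTorsion`), the Kummer
  naturality `resTorsion_kummerMapTorsion` and the bridge `kummerEquiv ∘ H¹(χ_θ) ∘ κ = x − θ` over `L`;
* `isSquare_mul_sub_of_resTorsion_eq` — in square-class currency: for `Φ(c) = [a]` and `P = (x, y)` affine,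
  `a · (x − θ) ∈ L²` at every such `L`; for `P = O`, `a ∈ L²`.

## References
* [Cassels1991LecturesEllipticCurves] J. W. S. Cassels, *Lectures on Elliptic Curves* (1991), §15.
* [SilvermanAEC2009] J. H. Silverman, *The Arithmetic of Elliptic Curves*, 2nd ed., X.§1 (Thm. X.1.1,
  Prop. X.1.4), X.§4 (diagram (**)).
* [SerreGaloisCohomology1997] J.-P. Serre, *Galois Cohomology*, I.§2.4, II.§1.1.
-/

noncomputable section

open scoped Classical

universe u

namespace WeierstrassCurve

open Literature.NumberTheory.GaloisRepresentations Literature.NumberTheory.EllipticCurves Field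
open WeierstrassCurve.Affine DiscreteGaloisModule

/-! ### A Selmer class restricts to a Kummer class of a local point -/

/-- **At every place, a Selmer class is the Kummer class of a local point** (`resTorsion` currency): for
`c ∈ Sel⁽²⁾(E/k)` and a place `v` of the number field `k`, `res_{k_v} c = κ(P)` for some `P ∈ E(k_v)`
(local condition `𝓛_v = im κ_v`, `range_localKummerMap`, read through `H¹(A⁻¹) ∘ resTorsion = res`).
[cite: SilvermanAEC2009, X.§4 diagram (**)] -/
theorem exists_resTorsion_eq_kummerMapTorsion_of_mem_selmerGroup {k : Type u} [Field k] [NumberField k]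
    (W : WeierstrassCurve k) [W.IsElliptic] {c : galH1Torsion W 2} (hc : c ∈ selmerGroup W 2)
    (v : NumberField.Place k) [CharZero (NumberField.Place.Completion v)]
    [(W.baseChange (NumberField.Place.Completion v)).IsElliptic] :
    ∃ P : (W.baseChange (NumberField.Place.Completion v)).toAffine.Point,
      resTorsion W (NumberField.Place.Completion v) 2 c =
        kummerMapTorsion (W.baseChange (NumberField.Place.Completion v)) 2
          (W.two_zsmul_geomPoints_baseChange_surjective (NumberField.Place.Completion v)) P := by
  have hv : galoisCohomology.res (W.torsionGaloisModule 2) (NumberField.Place.Completion v) 1 c ∈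
      W.kummerLocalConditionAt 2 (NumberField.Place.Completion v) :=
    (W.mem_selmerGroup_iff_forall_localization_mem 2 c).mp hc v
  rw [← W.range_localKummerMap (NumberField.Place.Completion v) (two_ne_zero : (2 : ℤ) ≠ 0),
    AddMonoidHom.mem_range] at hv
  obtain ⟨P, hP⟩ := hv
  refine ⟨P, (W.galH1TorsionBaseChangeEquiv (NumberField.Place.Completion v) two_ne_zero).injective ?_⟩
  rw [galH1TorsionBaseChangeEquiv_apply, galH1TorsionBaseChangeEquiv_apply,
    cohomologyMap_torsionTransferInvHom_resTorsion, ← localKummerMap_eq_cohomologyMap_kummerMapTorsion, hP]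

/-! ### The character along an equality of equations -/

/-- The `θ`-character on `H¹` commutes with the transport along an equality `V₁ = V₂` of Weierstrass equations
(both the character and the transport are the identity on coordinates). [cite: SerreGaloisCohomology1997, I.§2.4] -/
theorem oneRootCharH1_h1Equiv_torsionCongr {F : Type u} [Field F] [CharZero F] {V₁ V₂ : WeierstrassCurve F}
    [V₁.IsElliptic] [V₂.IsElliptic] (h : V₁ = V₂) {θ : F} (h₁ : V₁.toAffine.IsTwoTorsionX θ)
    (h₂ : V₂.toAffine.IsTwoTorsionX θ) (s : galH1Torsion V₁ 2) :
    V₂.oneRootCharH1 h₂ (h1Equiv (torsionByCongr (geomPointsCongr h) 2) (torsionCongr_smul 2 h) s) =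
      V₁.oneRootCharH1 h₁ s := by
  subst h
  rw [h1Equiv_torsionCongr_rfl]

/-! ### Uniformity -/

section Uniform

variable {k : Type u} [Field k] (W : WeierstrassCurve k)
  {K : Type u} [Field K] [Algebra k K] [CharZero K]
  {M : Type u} [Field M] [Algebra k M] [CharZero M]
  (L : Type u) [Field L] [Algebra k L] [Algebra K L] [Algebra M L] [IsScalarTower k K L] [IsScalarTower k M L]
  [CharZero L]
  {θ : K}

/-- **Local Cassels uniformity.** Let `E/k`, `K/k` with a root `θ ∈ K` of the `2`-division cubic, `M/k`
(e.g. `M = k_p`) and `L` a field over both `K` and `M` compatibly over `k` (e.g. `L = K_w`, `w ∣ p`). If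
`c ∈ H¹(k, E[2])` restricts over `M` to the Kummer class of `P ∈ E(M)`, then the image in `Lˣ/Lˣ²` of the
`θ`-component `Φ(c) = kummerEquiv K (H¹(χ_θ)(res_K c))` is the Cassels value `oneRootComponent θ P_L` of the base
change `P_L ∈ E(L)` — the SAME `M`-rational point for every such `L`. [cite: Cassels1991LecturesEllipticCurves, §15]
[cite: SilvermanAEC2009, Thm. X.1.1, Prop. X.1.4, X.§4 diagram (**)] [cite: SerreGaloisCohomology1997, II.§1.1] -/
theorem kummerEquiv_resMu_oneRootCharH1_eq_of_resTorsion_eq [(W.baseChange K).IsElliptic]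
    [(W.baseChange M).IsElliptic] [(W.baseChange L).IsElliptic] [((W.baseChange K).baseChange L).IsElliptic]
    [((W.baseChange M).baseChange L).IsElliptic]
    (hθ : (W.baseChange K).toAffine.IsTwoTorsionX θ) (c : galH1Torsion W 2)
    {hdiv : ∀ Q : geomPoints (W.baseChange M), ∃ R : geomPoints (W.baseChange M), (2 : ℤ) • R = Q}
    (P : (W.baseChange M).toAffine.Point)
    (hP : resTorsion W M 2 c = kummerMapTorsion (W.baseChange M) 2 hdiv P) :
    kummerEquiv L 2 (resMu K L 2 ((W.baseChange K).oneRootCharH1 hθ (resTorsion W K 2 c))) =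
      Additive.ofMul (Affine.Point.oneRootComponent ((W.baseChange M).baseChange L).toAffine (algebraMap K L θ)
        (Affine.Point.baseChange (W' := W.baseChange M) M L P)) := by
  have h₁ : (W.baseChange K).baseChange L = W.baseChange L := baseChange_baseChange W K L
  have h₂ : (W.baseChange M).baseChange L = W.baseChange L := baseChange_baseChange W M L
  have hθKL : ((W.baseChange K).baseChange L).toAffine.IsTwoTorsionX (algebraMap K L θ) :=
    (W.baseChange K).isTwoTorsionX_baseChange hθ L
  have hθL : (W.baseChange L).toAffine.IsTwoTorsionX (algebraMap K L θ) := h₁ ▸ hθKL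
  have hθML : ((W.baseChange M).baseChange L).toAffine.IsTwoTorsionX (algebraMap K L θ) := h₂.symm ▸ hθL
  -- Φ(c) at `L`, read on `(W⁄K)⁄L`
  rw [← (W.baseChange K).resOneRootCharH1_res L hθ,
    ← (W.baseChange K).cohomologyMap_torsionTransferInvHom_resTorsion (E := L) two_ne_zero,
    (W.baseChange K).resOneRootCharH1_cohomologyMap_torsionTransferInvHom L hθ]
  -- through the towers `k ⊂ K ⊂ L` and `k ⊂ M ⊂ L`
  have hK := resTorsion_resTorsion W 2 h₁ c
  have hM := resTorsion_resTorsion W 2 h₂ c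
  have eK : resTorsion (W.baseChange K) L 2 (resTorsion W K 2 c) =
      (h1Equiv (torsionByCongr (geomPointsCongr h₁) 2) (torsionCongr_smul 2 h₁)).symm
        (h1Equiv (torsionByCongr (geomPointsCongr h₂) 2) (torsionCongr_smul 2 h₂)
          (resTorsion (W.baseChange M) L 2 (resTorsion W M 2 c))) := by
    rw [hM, ← hK, AddEquiv.symm_apply_apply]
  rw [eK, ← oneRootCharH1_h1Equiv_torsionCongr h₁ hθKL hθL, AddEquiv.apply_symm_apply,
    oneRootCharH1_h1Equiv_torsionCongr h₂ hθML hθL, hP,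
    (W.baseChange M).resTorsion_kummerMapTorsion (E := L) two_ne_zero hdiv
      ((W.baseChange M).two_zsmul_geomPoints_baseChange_surjective L) P]
  exact ((W.baseChange M).baseChange L).kummerEquiv_oneRootCharH1_kummerMapTorsion hθML _ _

/-- **Uniformity in square classes.** In the situation of `kummerEquiv_resMu_oneRootCharH1_eq_of_resTorsion_eq`,
write `Φ(c) = [a]` with `a ∈ Kˣ`. If `P = O` then `a` is a square in `L`; if `P = (x, y)` then
`a · (x − θ) ∈ L²` (`x ∈ M` read in `L`) — with `x − θ = 0` allowed (then trivially). These are the per-place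
square data consumed by the local insolubility certificates of the `2`-descent.
[cite: Cassels1991LecturesEllipticCurves, §15] [cite: SilvermanAEC2009, Prop. X.1.4] -/
theorem isSquare_of_resTorsion_eq [(W.baseChange K).IsElliptic]
    [(W.baseChange M).IsElliptic] [(W.baseChange L).IsElliptic] [((W.baseChange K).baseChange L).IsElliptic]
    [((W.baseChange M).baseChange L).IsElliptic]
    (hθ : (W.baseChange K).toAffine.IsTwoTorsionX θ) (c : galH1Torsion W 2) (a : Kˣ)
    (ha : kummerEquiv K 2 ((W.baseChange K).oneRootCharH1 hθ (resTorsion W K 2 c)) =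
      Additive.ofMul (QuotientGroup.mk a))
    {hdiv : ∀ Q : geomPoints (W.baseChange M), ∃ R : geomPoints (W.baseChange M), (2 : ℤ) • R = Q}
    (P : (W.baseChange M).toAffine.Point)
    (hP : resTorsion W M 2 c = kummerMapTorsion (W.baseChange M) 2 hdiv P) :
    (P = 0 → IsSquare (algebraMap K L (a : K))) ∧
      ∀ {x y : M} (hxy : (W.baseChange M).toAffine.Nonsingular x y), P = Affine.Point.some x y hxy →
        IsSquare (algebraMap K L (a : K) * (algebraMap M L x - algebraMap K L θ)) := by
  have key := W.kummerEquiv_resMu_oneRootCharH1_eq_of_resTorsion_eq L hθ c P hP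
  have hc' : (W.baseChange K).oneRootCharH1 hθ (resTorsion W K 2 c) =
      (kummerEquiv K 2).symm (Additive.ofMul (QuotientGroup.mk a)) := by
    rw [← ha, AddEquiv.symm_apply_apply]
  rw [hc', kummerEquiv_resMu_symm] at key
  have hcls : (QuotientGroup.mk (Units.map (algebraMap K L : K →* L) a) : Lˣ ⧸ (powMonoidHom 2 : Lˣ →* Lˣ).range) =
      Affine.Point.oneRootComponent ((W.baseChange M).baseChange L).toAffine (algebraMap K L θ)
        (Affine.Point.baseChange (W' := W.baseChange M) M L P) := Additive.ofMul.injective key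
  constructor
  · intro h0
    subst h0
    have e0 : Affine.Point.baseChange (W' := W.baseChange M) M L (0 : (W.baseChange M).toAffine.Point) = 0 :=
      map_zero _
    rw [e0, Affine.Point.oneRootComponent_zero, QuotientGroup.eq_one_iff] at hcls
    obtain ⟨b, hb⟩ := hcls
    refine ⟨(b : L), ?_⟩
    have := congrArg (fun u : Lˣ => (u : L)) hb
    simpa [sq] using this.symm
  · intro x y hxy hPxy
    subst hPxy
    by_cases hx : algebraMap M L x = algebraMap K L θ
    · rw [hx, sub_self, mul_zero]; exact ⟨0, by simp⟩
    · obtain ⟨hL, hmap⟩ : ∃ hL, Affine.Point.baseChange (W' := W.baseChange M) M L (Affine.Point.some x y hxy) =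
          Affine.Point.some (algebraMap M L x) (algebraMap M L y) hL := ⟨_, rfl⟩
      have hcls' := hcls.trans (congrArg
        (Affine.Point.oneRootComponent ((W.baseChange M).baseChange L).toAffine (algebraMap K L θ)) hmap)
      rw [Affine.Point.oneRootComponent_some_of_ne _ hx, Affine.sqClass_of_ne_zero (sub_ne_zero.mpr hx),
        QuotientGroup.eq] at hcls'
      obtain ⟨b, hb⟩ := hcls'
      -- `(a)⁻¹ * (x − θ) = b²` in `Lˣ`
      have hb' := congrArg (fun u : Lˣ => (u : L)) hb
      simp only [powMonoidHom_apply, Units.val_mul, Units.val_pow_eq_pow_val, Units.val_inv_eq_inv_val,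
        Units.coe_map, MonoidHom.coe_coe, Units.val_mk0] at hb'
      have ha0 : algebraMap K L (a : K) ≠ 0 := by
        rw [map_ne_zero_iff _ (algebraMap K L).injective]; exact a.ne_zero
      refine ⟨algebraMap K L (a : K) * (b : L), ?_⟩
      have hxθ : algebraMap M L x - algebraMap K L θ = algebraMap K L (a : K) * (b : L) ^ 2 := by
        rw [hb']; field_simp
      linear_combination (algebraMap K L (a : K)) * hxθ

end Uniform

end WeierstrassCurve

end
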